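/-
Origin: expansion seat `planner-pub-hodgecm-pv04-g4-0`, handover 2026-08-18T05:52:22Z (`HOME/pub-hodgecm-pv04-g4/lean/Pv04g4/S6Strength.lean`, md5 c2a4b557, 70 lines);
landed by the gen-6 packager in gate run 24 as `HodgeCM/PerL34/S6Strength.lean` (verbatim).
-/
/-
Copyright: pub-hodgecm formalisation cell (harness21, 2026). New file (not vendored).
Origin: HOME/pub-hodgecm-pv04-g4/lean/Pv04g4/S6Strength.lean — session planner-pub-hodgecm-pv04-g4-0 (unit pub-hodgecm-pv04-g4),
DAG-node prover #04, generation 4 (seam S6 = node N12a).  WIP module `Pv04g4.S6Strength`; intended final place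
`HodgeCM/PerL34/S6Strength.lean` (module `HodgeCM.PerL34.S6Strength`; kind L5 — ONE NEW ADDITIVE FILE).  Imports only the
landed `HodgeCM.PerL34.ThetaSubIsogeny` (gate run 23, bf139ca6 → tree c8996bbc); no WIP import, no rewrite needed.
-/
import Summits.HodgeConjecture.HodgeCM.PerL34.ThetaSubIsogeny

/-!
# Seam S6 (node N12a `Open_thetaSub`): STRENGTH RECORD in the referees' P1 format

Referee A rounds 15/16, P1, asks for each instantiation-record / print-interface binder of the assembly: is the binder
EQUIVALENT to the node output it replaces (conservative), strictly STRONGER (locate the excess), and is it inhabited by a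
junk instance?  For seam S6 the binders are `hM38 : U.Fact_cmInflation` (class-M candidate model fact, Shimura 1998 §6.2
Thm 3; toy witness `Toy.fact_cmInflation`) and `hAlb : T.Fact_thetaAlbanese` ([Liu21] Prop 4.13 + Thm 4.18(1) read through
R1–R4), consumed by `PerL34.N12a_thetaSub_of_split` / `AssemblyRoutes.perL_of_openCharsWeilLeaves`.  This file only NAMES
the equivalences already in the kernel (`ThetaSubOfLiu.lean`, run 22; `ThetaSubIsogeny.lean`, run 23):

* `thetaAlbanese_iff_open (A : U.ModelAxioms) (h38 : U.Fact_cmInflation) : T.Fact_thetaAlbanese ↔ T.Open_thetaSub` —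
  CONSERVATIVE over the model axioms + M38; the direction `Open_thetaSub → Fact_thetaAlbanese` is hypothesis-free
  (`fact_thetaAlbanese_of_open`: trivial inflation `M = K`), the direction `→` uses exactly M2, M13, M38.
* `thetaAlbaneseIso_iff_open`, `thetaAlbaneseIso_iff_thetaAlbanese` — the same for the interface stated with Liu's own
  CM abelian variety (`Fact_thetaAlbaneseIso`); the last equivalence needs NO M38 (M1, M2, M13 only).
* No junk instance is offered or needed: unlike a free data record, `Fact_thetaAlbanese` is a closed `Prop` quantified over
  the model's own good seesaw contexts, and by the first equivalence it holds in a universe satisfying the model axioms +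
  M38 exactly when the node output N12a does.

VERDICT (GAPS.md `### pv04g4-S6`, `### pv04g4-R4`): S6 is CONSERVATIVE and of KNOWN strength; its non-kernel residue is
PRINT ([Liu21] 4.13 + 4.18(1); Shimura 1998 §6.1 Thm 2 Cor., §6.2 Thm 3) plus the object/class/type readings R1–R3.
Nothing is cited or posited here; standard axioms only.
-/

noncomputable section

namespace HodgeCM

namespace Universe

namespace ThetaModel

variable {U : Universe} (T : U.ThetaModel)

/-- **S6 conservative**: the [Liu21] interface binder is equivalent to the node output `Open_thetaSub`
(= `PerL34.N12a_thetaSub T` by `rfl`) over the model axioms and M38 `Fact_cmInflation`. -/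
theorem thetaAlbanese_iff_open (A : U.ModelAxioms) (h38 : U.Fact_cmInflation) :
    T.Fact_thetaAlbanese ↔ T.Open_thetaSub :=
  ⟨T.open_thetaSub_of_split A h38, T.fact_thetaAlbanese_of_open⟩

/-- The same for the interface stated with Liu's own CM abelian variety `A_μ` (`Fact_thetaAlbaneseIso`). -/
theorem thetaAlbaneseIso_iff_open (A : U.ModelAxioms) (h38 : U.Fact_cmInflation) :
    T.Fact_thetaAlbaneseIso ↔ T.Open_thetaSub :=
  ⟨T.open_thetaSub_of_iso_split A h38, T.fact_thetaAlbaneseIso_of_open A.pull_id⟩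

/-- The two [Liu21] interfaces are equivalent over M1, M2, M13 alone (no M38): the isogeny step R4 is kernel. -/
theorem thetaAlbaneseIso_iff_thetaAlbanese (A : U.ModelAxioms) :
    T.Fact_thetaAlbaneseIso ↔ T.Fact_thetaAlbanese :=
  ⟨T.fact_thetaAlbanese_of_iso A.pull_comp A.alphaLine, T.fact_thetaAlbaneseIso_of A.pull_id⟩

/-- Hypothesis-free direction, recorded by name for the census: the node output implies the interface binder outright. -/
theorem thetaAlbanese_of_open : T.Open_thetaSub → T.Fact_thetaAlbanese :=
  T.fact_thetaAlbanese_of_open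

end ThetaModel

end Universe

end HodgeCM

end
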